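import Literature.MeasureTheory.Group.LatticeCovolumeDescent
import Literature.NumberTheory.Automorphic.UnitaryGroupHermitianOrbitCount
import Literature.NumberTheory.Automorphic.LatticeUnimodular
import Literature.Topology.Algebra.StabilizerDescent
import Literature.Topology.Metrizable.LocallyCompactPolish
import HarnessLib

/-!
# Borel–Harish-Chandra by descent, generic form: a closed stabiliser `Stab(x₀) ≤ GL_n(𝔸_K)` meets `GL_n(K)`
# in a lattice as soon as the orbit count of the rational points is Siegel-integrable

Topic `NumberTheory/Automorphic`; namespace `Literature.NumberTheory.Automorphic` (sub-namespace `RightActionData`, theorems about the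
tree's `Literature.Topology.Algebra.RightActionData`, invoked as `RightActionData.foo A …`). Proof file: theorems only, no definition,
no named fact, no `sorry`.

This is the finite-VOLUME companion of the tree's compactness descent `RightActionData.exists_isCompact_descent`
(`Literature.Topology.Algebra.StabilizerDescent`, Mostow–Tamagawa), abstracting the unitary-group files
`UnitaryGroupHermitianOrbitCount` ∕ `UnitaryGroupFiniteCovolume` (where `X = M_N(𝔸_L)`, `x · g = (cg)ᵀ x g`, `x₀ = H_𝔸`,
`D` = base changes of rational hermitian matrices) to ANY continuous right action: orthogonal groups `O(Q)` (`x · g = gᵀ x g`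
on symmetric matrices), `Sp`, stabilisers of tensors, … get their finite covolume from the SAME ★ reduction theory of `GL_n`.

Setting: `K` a number field, `R = GL_n(𝔸_K)`, `A : RightActionData R X` a right action on a topological space `X` with
`x ↦ x · g` continuous for each `g`, `x₀ ∈ X` with CLOSED stabiliser `U = Stab(x₀)`, `Γ = GL_n(K)` (`rationalPointsGL`), and a
`Γ`-STABLE set `D ∋ x₀` of «rational points» of `X` meeting every compact set in a finite set; assume `|det u|_𝔸 = 1` on `U`.

* §1 `act_eq_act_iff` (fibres of `γ ↦ x₀ · γ` are the cosets `U γ`), `finite_orbitSet`, `encard_orbitSet_mul_left`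
  (left `Γ`-invariance of `g ↦ #{d ∈ D : d · g ∈ B}`), `encard_image_act_le` (THE ORBIT-COUNT BOUND
  `#{x₀ · γ : γ g ∈ U P} ≤ #{d ∈ D : d · g ∈ x₀ · P}`), `mem_normBand_of_mul_mem` (support in the norm band);
* §2 **`measure_lt_top_of_orbitCount`** — if `g ↦ #{d ∈ D : d · g ∈ B}` is integrable over every thickened Siegel set of `GL_n(𝔸_K)`
  for every compact `B` (`hcount`), then every measurable fundamental domain of `U ∩ Γ` acting on the left of `U` has FINITE Haar
  measure (orbit-count unfolding ★ `measure_fundamentalDomain_lt_top_of_lintegral_encard_lt_top` + the left Siegel cover of the norm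
  band ★ `normBand_subset_iUnion_smul_left` + domination ★ `setLIntegral_inter_le_of_subset_iUnion_smul`);
* §3 **`exists_lattice_of_orbitCount`** — hence `U ∩ Γ` is a LATTICE in `U`: a strict measurable fundamental domain `F` with
  `0 < ν F < ∞`, `U` unimodular (★ `isMulRightInvariant_of_isFundamentalDomain`), `ν F⁻¹ = ν F` and `F⁻¹ · (U ∩ Γ) = U` — the exact
  input of the covering-set constructors of automorphic measures (`…exists_isAutomorphicMeasure_of_cover_of_center'_eq_bot`).

## References

* A. Borel, Harish-Chandra, *Arithmetic subgroups of algebraic groups*, Ann. of Math. 75 (1962), §7 Thm. 7.8, §9 Lemma 9.4.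
  [BorelHarishChandra1962]
* A. Borel, *Some finiteness properties of adele groups over number fields*, Publ. Math. IHÉS 16 (1963), §5 Thm. 5.8. [Borel1963]
* R. Godement, *Domaines fondamentaux des groupes arithmétiques*, Sém. Bourbaki 257, §4, §8. [Godement1964]
-/

set_option autoImplicit false

noncomputable section

open MeasureTheory Measure NumberField IsDedekindDomain Matrix Set
open scoped MatrixGroups NNReal ENNReal Pointwise

namespace Literature.NumberTheory.Automorphic

open Literature.Topology.Algebra Literature.MeasureTheory.Group

variable {K : Type} [Field K] [NumberField K] {n : ℕ} {X : Type*}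
  (A : RightActionData (GL (Fin n) (AdeleRing (𝓞 K) K)) X)

/-! ## §1 The orbit count of a right action -/

/-- **Fibres of the orbit map are the stabiliser cosets**: `x₀ · g = x₀ · g' ↔ g' g⁻¹ ∈ Stab(x₀)`.
[cite: BorelHarishChandra1962, §9 Lemma 9.4] -/
theorem RightActionData.act_eq_act_iff (x₀ : X) (g g' : GL (Fin n) (AdeleRing (𝓞 K) K)) :
    A.act x₀ g = A.act x₀ g' ↔ g' * g⁻¹ ∈ A.stabilizer x₀ := by
  rw [RightActionData.mem_stabilizer_iff]
  constructor
  · intro h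
    rw [A.act_mul, ← h, A.act_mul_inv_cancel]
  · intro h
    have : A.act x₀ (g' * g⁻¹ * g) = A.act x₀ g := by rw [A.act_mul, h]
    rw [← this, inv_mul_cancel_right]

/-- **The orbit set is finite**: if `x ↦ x · g` is continuous and `D` meets compact sets finitely, then for compact `B` the points
`d ∈ D` with `d · g ∈ B` form a finite set (`d = (d · g) · g⁻¹` lies in the compact `B · g⁻¹`). [cite: Godement1964, §4] -/
theorem RightActionData.finite_orbitSet [TopologicalSpace X] (hcont : ∀ g : GL (Fin n) (AdeleRing (𝓞 K) K),
      Continuous fun x => A.act x g)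
    {D : Set X} (hD : ∀ C : Set X, IsCompact C → (C ∩ D).Finite) {B : Set X} (hB : IsCompact B)
    (g : GL (Fin n) (AdeleRing (𝓞 K) K)) : {d : X | d ∈ D ∧ A.act d g ∈ B}.Finite := by
  refine (hD _ (hB.image (hcont g⁻¹))).subset ?_
  rintro d ⟨hdD, hdB⟩
  exact ⟨⟨A.act d g, hdB, A.act_mul_inv_cancel d g⟩, hdD⟩

/-- **Left `Γ`-invariance of the orbit count**: if `D · γ ⊆ D` for `γ ∈ Γ` then `d ↦ d · γ` is a bijection of `D` carrying
`{d : d · (γ g) ∈ B}` onto `{d : d · g ∈ B}`, so the counts agree. [cite: Godement1964, §4] -/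
theorem RightActionData.encard_orbitSet_mul_left {Γ : Subgroup (GL (Fin n) (AdeleRing (𝓞 K) K))} {D : Set X}
    (hDΓ : ∀ γ ∈ Γ, ∀ d ∈ D, A.act d γ ∈ D) (B : Set X) {γ : GL (Fin n) (AdeleRing (𝓞 K) K)} (hγ : γ ∈ Γ)
    (g : GL (Fin n) (AdeleRing (𝓞 K) K)) :
    {d : X | d ∈ D ∧ A.act d (γ * g) ∈ B}.encard = {d : X | d ∈ D ∧ A.act d g ∈ B}.encard := by
  let e : X ≃ X := ⟨fun d => A.act d γ, fun d => A.act d γ⁻¹, fun d => A.act_mul_inv_cancel d γ,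
    fun d => A.act_inv_mul_cancel d γ⟩
  have hset : {d : X | d ∈ D ∧ A.act d (γ * g) ∈ B} = e ⁻¹' {d : X | d ∈ D ∧ A.act d g ∈ B} := by
    ext d
    simp only [Set.mem_setOf_eq, Set.mem_preimage]
    constructor
    · rintro ⟨hd, hdg⟩
      exact ⟨hDΓ γ hγ d hd, by rwa [A.act_mul] at hdg⟩
    · rintro ⟨hd, hdg⟩
      refine ⟨?_, by rwa [A.act_mul]⟩
      have := hDΓ γ⁻¹ (Γ.inv_mem hγ) _ hd
      rwa [show A.act (e d) γ⁻¹ = d from A.act_mul_inv_cancel d γ] at this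
  rw [hset]
  exact Set.encard_preimage_of_bijective e.bijective _

/-- **The orbit-count bound.** With `x₀ ∈ D` and `D · Γ ⊆ D`: for `γ ∈ Γ` with `γ g ∈ U · P` (`U = Stab(x₀)`) the point `x₀ · γ` lies in
`D` and `(x₀ · γ) · g = x₀ · (u p) = x₀ · p`; hence `#{x₀ · γ : γ ∈ Γ, γ g ∈ U P} ≤ #{d ∈ D : d · g ∈ x₀ · P}`.
[cite: BorelHarishChandra1962, §9 Lemma 9.4] [cite: Godement1964, §4] -/
theorem RightActionData.encard_image_act_le {Γ : Subgroup (GL (Fin n) (AdeleRing (𝓞 K) K))} {x₀ : X} {D : Set X}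
    (hx₀ : x₀ ∈ D) (hDΓ : ∀ γ ∈ Γ, ∀ d ∈ D, A.act d γ ∈ D) (P : Set (GL (Fin n) (AdeleRing (𝓞 K) K)))
    (g : GL (Fin n) (AdeleRing (𝓞 K) K)) :
    ((fun γ : Γ => A.act x₀ (γ : GL (Fin n) (AdeleRing (𝓞 K) K))) ''
        {γ : Γ | (γ : GL (Fin n) (AdeleRing (𝓞 K) K)) * g ∈
          (A.stabilizer x₀ : Set (GL (Fin n) (AdeleRing (𝓞 K) K))) * P}).encard ≤
      {d : X | d ∈ D ∧ A.act d g ∈ (fun p : GL (Fin n) (AdeleRing (𝓞 K) K) => A.act x₀ p) '' P}.encard := by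
  refine Set.encard_le_encard ?_
  rintro _ ⟨γ, hγ, rfl⟩
  obtain ⟨u, hu, p, hp, hup⟩ := Set.mem_mul.1 hγ
  refine ⟨hDΓ _ γ.2 _ hx₀, p, hp, ?_⟩
  rw [← A.act_mul, ← hup, A.act_mul, (RightActionData.mem_stabilizer_iff A).1 hu]

/-- **Support in the norm band**: if `|det| = 1` on `Stab(x₀)`, `γ` is rational and `γ g ∈ Stab(x₀) · P` with `P` inside the norm band,
then `g` lies in the norm band. [cite: Borel1963, §5] -/
theorem RightActionData.mem_normBand_of_mul_mem {x₀ : X}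
    (hdet : ∀ u ∈ A.stabilizer x₀, glAbsDet n K u = 1) {P : Set (GL (Fin n) (AdeleRing (𝓞 K) K))}
    (hP : P ⊆ normBand n K) {γ g : GL (Fin n) (AdeleRing (𝓞 K) K)} (hγ : γ ∈ rationalPointsGL n K)
    (h : γ * g ∈ (A.stabilizer x₀ : Set (GL (Fin n) (AdeleRing (𝓞 K) K))) * P) : g ∈ normBand n K := by
  obtain ⟨u, hu, p, hp, hup⟩ := Set.mem_mul.1 h
  have hg : glAbsDet n K g = glAbsDet n K p := by
    have h1 : glAbsDet n K (γ * g) = glAbsDet n K (u * p) := by rw [hup]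
    rw [map_mul, map_mul, glAbsDet_eq_one_of_mem_rationalPointsGL hγ, hdet u hu, one_mul, one_mul] at h1
    exact h1
  have := hP hp
  rw [mem_normBand_iff] at this ⊢
  rw [hg]
  exact this

/-! ## §2 Finite covolume of `Stab(x₀) ∩ GL_n(K)` in `Stab(x₀)` from a Siegel-integrable orbit count -/

/-- **Finite covolume of `Stab(x₀) ∩ GL_n(K)` in `Stab(x₀)` by orbit-count unfolding** (Borel–Harish-Chandra's finiteness theorem
for a closed stabiliser, descended from the reduction theory of `GL_n(𝔸_K)`). Let `A` be a right action of `GL_n(𝔸_K)` on `X` with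
`x ↦ x · g` continuous, `U = Stab(x₀)` closed with `|det u|_𝔸 = 1` on `U`, `D ∋ x₀` a `GL_n(K)`-stable set meeting compact sets finitely,
`ν` a Haar measure on `U`, `Λ ≤ U` the subgroup `U ∩ GL_n(K)`, `F_U` a measurable fundamental domain of its left action. ASSUME the
orbit count `g ↦ #{d ∈ D : d · g ∈ B}` is integrable over every thickened Siegel set `Z Ω A_t K` for every compact `B` (`hcount`).
Then `ν(F_U) < ∞`. [cite: BorelHarishChandra1962, §7 Thm. 7.8] [cite: Borel1963, §5 Thm. 5.8] -/
theorem RightActionData.measure_lt_top_of_orbitCount [TopologicalSpace X]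
    (hcont : ∀ g : GL (Fin n) (AdeleRing (𝓞 K) K), Continuous fun x => A.act x g)
    {x₀ : X} (hcont₀ : Continuous fun g => A.act x₀ g)
    (hU : IsClosed (A.stabilizer x₀ : Set (GL (Fin n) (AdeleRing (𝓞 K) K))))
    (hdet : ∀ u ∈ A.stabilizer x₀, glAbsDet n K u = 1)
    {D : Set X} (hx₀ : x₀ ∈ D) (hDΓ : ∀ γ ∈ rationalPointsGL n K, ∀ d ∈ D, A.act d γ ∈ D)
    (hD : ∀ C : Set X, IsCompact C → (C ∩ D).Finite)
    (hcount : ∀ (_ : MeasurableSpace (GL (Fin n) (AdeleRing (𝓞 K) K)))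
      (_ : BorelSpace (GL (Fin n) (AdeleRing (𝓞 K) K)))
      (μ : Measure (GL (Fin n) (AdeleRing (𝓞 K) K))) (_ : μ.IsHaarMeasure)
      (B : Set X), IsCompact B →
      ∀ (Ω : Set (GL (Fin n) (AdeleRing (𝓞 K) K))) (t : ℝ) (Z : Set (GL (Fin n) (AdeleRing (𝓞 K) K))),
        0 < t → IsCompact Ω →
        Ω ⊆ (standardParabolicGL (AdeleRing (𝓞 K) K) (id : Fin n → Fin n) :
          Set (GL (Fin n) (AdeleRing (𝓞 K) K))) →
        IsCompact Z → Z ⊆ Set.range (posRealScalar n K) →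
        ∫⁻ g in Z * (Ω * siegelCone n K t *
            (standardMaximalCompactGL n K : Set (GL (Fin n) (AdeleRing (𝓞 K) K)))),
          (({d : X | d ∈ D ∧ A.act d g ∈ B}.ncard : ℕ) : ℝ≥0∞) ∂μ < ⊤)
    [MeasurableSpace (A.stabilizer x₀)] [BorelSpace (A.stabilizer x₀)]
    (ν : Measure (A.stabilizer x₀)) [ν.IsHaarMeasure]
    (Λ : Subgroup (A.stabilizer x₀)) [Countable Λ]
    (hΛ : ∀ u : A.stabilizer x₀, u ∈ Λ ↔ (u : GL (Fin n) (AdeleRing (𝓞 K) K)) ∈ rationalPointsGL n K)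
    {F_U : Set (A.stabilizer x₀)} (hFUm : MeasurableSet F_U)
    (hFU : IsFundamentalDomain Λ F_U ν) : ν F_U < ∞ := by
  classical
  -- the ambient group `R = GL_n(𝔸_K)`
  letI mR : MeasurableSpace (GL (Fin n) (AdeleRing (𝓞 K) K)) := borel _
  haveI bR : BorelSpace (GL (Fin n) (AdeleRing (𝓞 K) K)) := ⟨rfl⟩
  haveI : T2Space (GL (Fin n) (AdeleRing (𝓞 K) K)) := t2Space_gl n K
  haveI : LocallyCompactSpace (GL (Fin n) (AdeleRing (𝓞 K) K)) :=
    AdelicGroupData.locallyCompactSpace_generalLinearGroup_adeleRing K (Fin n)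
  haveI : SecondCountableTopology (GL (Fin n) (AdeleRing (𝓞 K) K)) :=
    secondCountableTopology_generalLinearGroup_adeleRing K (Fin n)
  set μ : Measure (GL (Fin n) (AdeleRing (𝓞 K) K)) := haar with hμ
  -- the closed subgroup `U` is locally compact
  haveI : LocallyCompactSpace (A.stabilizer x₀) := hU.isClosedEmbedding_subtypeVal.locallyCompactSpace
  haveI : SecondCountableTopology (A.stabilizer x₀) := TopologicalSpace.Subtype.secondCountableTopology _
  haveI : SigmaCompactSpace (A.stabilizer x₀) := sigmaCompactSpace_of_locallyCompact_secondCountable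
  haveI : DiscreteTopology (rationalPointsGL n K) := gl_isDiscreteRational_holds n K
  haveI : Countable (rationalPointsGL n K) := countable_rationalPointsGL n K
  obtain ⟨F_R, -, hFR⟩ :=
    Literature.MeasureTheory.Group.Subgroup.exists_isFundamentalDomain_of_discrete
      (rationalPointsGL n K) μ
  -- a compact neighbourhood `P` of `1` inside the norm band, of positive measure
  obtain ⟨P₀, hP₀c, hP₀1⟩ := exists_compact_mem_nhds (1 : GL (Fin n) (AdeleRing (𝓞 K) K))
  set P : Set (GL (Fin n) (AdeleRing (𝓞 K) K)) := P₀ ∩ normBand n K with hP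
  have hPc : IsCompact P := hP₀c.inter_right (isClosed_normBand n K)
  have hPD : P ⊆ normBand n K := Set.inter_subset_right
  have hP0 : μ P ≠ 0 := by
    set O : Set (GL (Fin n) (AdeleRing (𝓞 K) K)) := interior P₀ ∩
      ((fun g => ((glAbsDet n K g : ℝ≥0) : ℝ)) ⁻¹' Set.Ioo (1 / 2) 2) with hO
    have hOo : IsOpen O :=
      isOpen_interior.inter (isOpen_Ioo.preimage (continuous_glAbsDet_real n K))
    have h1O : (1 : GL (Fin n) (AdeleRing (𝓞 K) K)) ∈ O := by
      refine ⟨mem_interior_iff_mem_nhds.2 hP₀1, ?_⟩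
      change ((glAbsDet n K 1 : ℝ≥0) : ℝ) ∈ Set.Ioo (1 / 2 : ℝ) 2
      rw [map_one, Units.val_one, NNReal.coe_one]
      norm_num
    have hOP : O ⊆ P := fun g hg => ⟨interior_subset hg.1, ⟨hg.2.1.le, hg.2.2.le⟩⟩
    exact fun h0 => (hOo.measure_pos μ ⟨1, h1O⟩).ne' (measure_mono_null hOP h0)
  -- the class map `γ ↦ x₀ · γ`
  have hτ : ∀ γ γ' : rationalPointsGL n K,
      A.act x₀ (γ : GL (Fin n) (AdeleRing (𝓞 K) K)) = A.act x₀ (γ' : GL (Fin n) (AdeleRing (𝓞 K) K)) ↔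
        (γ' : GL (Fin n) (AdeleRing (𝓞 K) K)) * ((γ : GL (Fin n) (AdeleRing (𝓞 K) K)))⁻¹ ∈ A.stabilizer x₀ :=
    fun γ γ' => RightActionData.act_eq_act_iff A x₀ _ _
  -- the orbit-count integral over `F_R` is finite
  obtain ⟨Ω, t, Z, ht, hΩc, hΩB, hZc, hZr, hDsub⟩ := UnitaryGroup.normBand_subset_iUnion_smul_left K n
  set B : Set X := (fun p : GL (Fin n) (AdeleRing (𝓞 K) K) => A.act x₀ p) '' P with hB
  have hBc : IsCompact B := hPc.image hcont₀
  have hT5 := hcount mR bR μ inferInstance B hBc Ω t Z ht hΩc hΩB hZc hZr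
  set Θ : GL (Fin n) (AdeleRing (𝓞 K) K) → ℝ≥0∞ := fun g =>
    ({d : X | d ∈ D ∧ A.act d g ∈ B}.encard : ℝ≥0∞) with hΘ
  have hΘinv : ∀ (γ : rationalPointsGL n K) (g : GL (Fin n) (AdeleRing (𝓞 K) K)),
      Θ ((γ : GL (Fin n) (AdeleRing (𝓞 K) K)) * g) = Θ g := fun γ g => by
    simp only [hΘ]
    rw [RightActionData.encard_orbitSet_mul_left A hDΓ B γ.2 g]
  have hΘeq : ∀ g, Θ g = (({d : X | d ∈ D ∧ A.act d g ∈ B}.ncard : ℕ) : ℝ≥0∞) := fun g => by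
    simp only [hΘ]
    rw [← (RightActionData.finite_orbitSet A hcont hD hBc g).cast_ncard_eq, ENat.toENNReal_coe]
  have hint : ∫⁻ g in F_R, ((((fun γ : rationalPointsGL n K =>
        A.act x₀ (γ : GL (Fin n) (AdeleRing (𝓞 K) K))) ''
        {γ : rationalPointsGL n K | (γ : GL (Fin n) (AdeleRing (𝓞 K) K)) * g ∈
          (A.stabilizer x₀ : Set (GL (Fin n) (AdeleRing (𝓞 K) K))) * P}).encard : ℝ≥0∞)) ∂μ < ∞ := by
    have hpt : ∀ g, ((((fun γ : rationalPointsGL n K =>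
        A.act x₀ (γ : GL (Fin n) (AdeleRing (𝓞 K) K))) ''
        {γ : rationalPointsGL n K | (γ : GL (Fin n) (AdeleRing (𝓞 K) K)) * g ∈
          (A.stabilizer x₀ : Set (GL (Fin n) (AdeleRing (𝓞 K) K))) * P}).encard : ℝ≥0∞)) ≤
        (normBand n K).indicator Θ g := by
      intro g
      by_cases hg : g ∈ normBand n K
      · rw [Set.indicator_of_mem hg]
        simp only [hΘ]
        exact ENat.toENNReal_le.2 (RightActionData.encard_image_act_le A hx₀ hDΓ P g)
      · rw [Set.indicator_of_notMem hg]
        have hempty : {γ : rationalPointsGL n K | (γ : GL (Fin n) (AdeleRing (𝓞 K) K)) * g ∈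
            (A.stabilizer x₀ : Set (GL (Fin n) (AdeleRing (𝓞 K) K))) * P} = ∅ :=
          Set.eq_empty_of_forall_notMem fun γ hγ => hg (RightActionData.mem_normBand_of_mul_mem A hdet hPD γ.2 hγ)
        rw [hempty, Set.image_empty, Set.encard_empty]
        simp
    calc _ ≤ ∫⁻ g in F_R, (normBand n K).indicator Θ g ∂μ := lintegral_mono fun g => hpt g
      _ = ∫⁻ g in F_R ∩ normBand n K, Θ g ∂μ := by
          rw [lintegral_indicator (isClosed_normBand n K).measurableSet,
            Measure.restrict_restrict (isClosed_normBand n K).measurableSet, Set.inter_comm]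
      _ ≤ ∫⁻ g in Z * (Ω * siegelCone n K t *
            (standardMaximalCompactGL n K : Set (GL (Fin n) (AdeleRing (𝓞 K) K)))), Θ g ∂μ :=
          setLIntegral_inter_le_of_subset_iUnion_smul (rationalPointsGL n K) μ hFR hΘinv hDsub
      _ = ∫⁻ g in Z * (Ω * siegelCone n K t *
            (standardMaximalCompactGL n K : Set (GL (Fin n) (AdeleRing (𝓞 K) K)))),
            (({d : X | d ∈ D ∧ A.act d g ∈ B}.ncard : ℕ) : ℝ≥0∞) ∂μ := lintegral_congr fun g => hΘeq g
      _ < ∞ := hT5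
  exact measure_fundamentalDomain_lt_top_of_lintegral_encard_lt_top (A.stabilizer x₀) hU μ ν
    (rationalPointsGL n K) hFR Λ hΛ hFU hFUm hPc hP0 _ hτ hint

/-! ## §3 `Stab(x₀) ∩ GL_n(K)` is a lattice in `Stab(x₀)`: unimodularity and the cover by a fundamental domain -/

/-- **`Stab(x₀) ∩ GL_n(K)` is a lattice in the closed stabiliser `Stab(x₀)`** (same hypotheses as `measure_lt_top_of_orbitCount`, with
`Λ = Stab(x₀) ∩ GL_n(K)` as a subgroup of `Stab(x₀)`): there is a strict measurable fundamental domain `F` for the left action of `Λ` with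
`0 < ν F < ∞`; consequently `Stab(x₀)` is UNIMODULAR (tree `isMulRightInvariant_of_isFundamentalDomain`), `ν F⁻¹ = ν F` and
`F⁻¹ · Λ = Stab(x₀)` — the input of the covering-set constructors of automorphic measures.  (The instance
`[LocallyCompactSpace (A.stabilizer x₀)]` is `hU.isClosedEmbedding_subtypeVal.locallyCompactSpace`; it is a binder so that the
unimodularity clause can be stated.) [cite: BorelHarishChandra1962, §7 Thm. 7.8] [cite: Borel1963, §5 Thm. 5.8] -/
theorem RightActionData.exists_lattice_of_orbitCount [TopologicalSpace X]
    (hcont : ∀ g : GL (Fin n) (AdeleRing (𝓞 K) K), Continuous fun x => A.act x g)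
    {x₀ : X} (hcont₀ : Continuous fun g => A.act x₀ g)
    (hU : IsClosed (A.stabilizer x₀ : Set (GL (Fin n) (AdeleRing (𝓞 K) K))))
    (hdet : ∀ u ∈ A.stabilizer x₀, glAbsDet n K u = 1)
    {D : Set X} (hx₀ : x₀ ∈ D) (hDΓ : ∀ γ ∈ rationalPointsGL n K, ∀ d ∈ D, A.act d γ ∈ D)
    (hD : ∀ C : Set X, IsCompact C → (C ∩ D).Finite)
    (hcount : ∀ (_ : MeasurableSpace (GL (Fin n) (AdeleRing (𝓞 K) K)))
      (_ : BorelSpace (GL (Fin n) (AdeleRing (𝓞 K) K)))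
      (μ : Measure (GL (Fin n) (AdeleRing (𝓞 K) K))) (_ : μ.IsHaarMeasure)
      (B : Set X), IsCompact B →
      ∀ (Ω : Set (GL (Fin n) (AdeleRing (𝓞 K) K))) (t : ℝ) (Z : Set (GL (Fin n) (AdeleRing (𝓞 K) K))),
        0 < t → IsCompact Ω →
        Ω ⊆ (standardParabolicGL (AdeleRing (𝓞 K) K) (id : Fin n → Fin n) :
          Set (GL (Fin n) (AdeleRing (𝓞 K) K))) →
        IsCompact Z → Z ⊆ Set.range (posRealScalar n K) →
        ∫⁻ g in Z * (Ω * siegelCone n K t *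
            (standardMaximalCompactGL n K : Set (GL (Fin n) (AdeleRing (𝓞 K) K)))),
          (({d : X | d ∈ D ∧ A.act d g ∈ B}.ncard : ℕ) : ℝ≥0∞) ∂μ < ⊤)
    [LocallyCompactSpace (A.stabilizer x₀)]
    [MeasurableSpace (A.stabilizer x₀)] [BorelSpace (A.stabilizer x₀)]
    (ν : Measure (A.stabilizer x₀)) [ν.IsHaarMeasure]
    (Λ : Subgroup (A.stabilizer x₀))
    (hΛ : ∀ u : A.stabilizer x₀, u ∈ Λ ↔ (u : GL (Fin n) (AdeleRing (𝓞 K) K)) ∈ rationalPointsGL n K) :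
    ∃ F : Set (A.stabilizer x₀), MeasurableSet F ∧ (∀ u : A.stabilizer x₀, ∃! γ : Λ, γ • u ∈ F) ∧
      IsFundamentalDomain Λ F ν ∧ ν F ≠ 0 ∧ ν F < ∞ ∧ ν.IsMulRightInvariant ∧
      (∀ g : A.stabilizer x₀, modularCharacter g = 1) ∧ ν F⁻¹ = ν F ∧
      (QuotientGroup.mk : A.stabilizer x₀ → A.stabilizer x₀ ⧸ Λ) '' F⁻¹ = Set.univ := by
  classical
  haveI : T2Space (GL (Fin n) (AdeleRing (𝓞 K) K)) := t2Space_gl n K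
  haveI : LocallyCompactSpace (GL (Fin n) (AdeleRing (𝓞 K) K)) :=
    AdelicGroupData.locallyCompactSpace_generalLinearGroup_adeleRing K (Fin n)
  haveI : SecondCountableTopology (GL (Fin n) (AdeleRing (𝓞 K) K)) :=
    secondCountableTopology_generalLinearGroup_adeleRing K (Fin n)
  haveI : SecondCountableTopology (A.stabilizer x₀) := TopologicalSpace.Subtype.secondCountableTopology _
  haveI : PolishSpace (A.stabilizer x₀) :=
    Literature.Topology.Metrizable.polishSpace_of_locallyCompactSpace_of_secondCountableTopology _
  -- `Λ` is discrete (it injects continuously into the discrete `GL_n(K)`), hence countable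
  haveI : DiscreteTopology (rationalPointsGL n K) := gl_isDiscreteRational_holds n K
  haveI : DiscreteTopology Λ := by
    refine DiscreteTopology.of_continuous_injective
      (f := fun x : Λ => (⟨((x : A.stabilizer x₀) : GL (Fin n) (AdeleRing (𝓞 K) K)), (hΛ x).1 x.2⟩ :
        rationalPointsGL n K)) ?_ ?_
    · exact (continuous_subtype_val.comp continuous_subtype_val).subtype_mk _
    · intro a b hab
      have h : ((a : A.stabilizer x₀) : GL (Fin n) (AdeleRing (𝓞 K) K)) =
          ((b : A.stabilizer x₀) : GL (Fin n) (AdeleRing (𝓞 K) K)) :=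
        congrArg (fun y : rationalPointsGL n K => (y : GL (Fin n) (AdeleRing (𝓞 K) K))) hab
      exact Subtype.ext (Subtype.ext h)
  haveI : Countable Λ := by
    haveI : SecondCountableTopology Λ := TopologicalSpace.Subtype.secondCountableTopology _
    exact countable_of_Lindelof_of_discrete
  -- a strict Borel fundamental domain
  obtain ⟨F, hFm, hFs⟩ :=
    Literature.MeasureTheory.Group.Subgroup.exists_measurableSet_existsUnique_smul_mem Λ
  have hF : IsFundamentalDomain Λ F ν := IsFundamentalDomain.mk' hFm.nullMeasurableSet hFs
  have htop : ν F < ∞ :=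
    RightActionData.measure_lt_top_of_orbitCount A hcont hcont₀ hU hdet hx₀ hDΓ hD hcount ν Λ hΛ hFm hF
  have h0 : ν F ≠ 0 := by
    intro h0
    have hcov : (⋃ γ : Λ, γ • F) = Set.univ := by
      refine Set.eq_univ_of_forall fun u => ?_
      obtain ⟨γ, hγ, -⟩ := hFs u
      refine Set.mem_iUnion.2 ⟨γ⁻¹, ?_⟩
      rw [Set.mem_smul_set_iff_inv_smul_mem, inv_inv]
      exact hγ
    have hnull : ν (⋃ γ : Λ, γ • F) = 0 := measure_iUnion_null fun γ => by rw [measure_smul]; exact h0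
    rw [hcov] at hnull
    exact (isOpen_univ.measure_ne_zero ν Set.univ_nonempty) hnull
  have hΔ : ∀ g : A.stabilizer x₀, modularCharacter g = 1 := fun g =>
    modularCharacterFun_eq_one_of_isFundamentalDomain Λ ν hF h0 htop.ne g
  haveI hri : ν.IsMulRightInvariant := isMulRightInvariant_of_isFundamentalDomain Λ ν hF h0 htop.ne
  haveI : ν.IsInvInvariant := isInvInvariant_of_isMulRightInvariant ν
  have hcov : (QuotientGroup.mk : A.stabilizer x₀ → A.stabilizer x₀ ⧸ Λ) '' F⁻¹ = Set.univ := by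
    refine Set.eq_univ_of_forall fun q => ?_
    induction q using QuotientGroup.induction_on with
    | H u =>
      obtain ⟨γ, hγ, -⟩ := hFs u⁻¹
      rw [Subgroup.smul_def, smul_eq_mul] at hγ
      refine ⟨u * (γ : A.stabilizer x₀)⁻¹, ?_, QuotientGroup.mk_mul_of_mem u (Λ.inv_mem γ.2)⟩
      rw [Set.mem_inv, _root_.mul_inv_rev, inv_inv]
      exact hγ
  exact ⟨F, hFm, hFs, hF, h0, htop, hri, hΔ, by rw [measure_inv], hcov⟩

end Literature.NumberTheory.Automorphic

end
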